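import Summits.QuantumFields.BalabanUV.Beta.GAN24.ContactCellReduction
import Summits.QuantumFields.BalabanUV.Beta.GAN24.ContactCellLetters
import Summits.QuantumFields.BalabanUV.Beta.GAN24.StaircasePairingReadings

/-!
# `BalabanUV.Beta.GAN24.ContactCellBounds` — binder row G-an2-4 / (CONV-C), the row owner's CONTACT-TERM ROUTE (`gen19/CT3-MECHANISM-v1.2.md` §A–§B), CT-3c
# analysis at `d = 3`, `m = 0`: THE THREE ONE-GAUGE CELLS OF THE CONTACT TERM BOUNDED IN CLOSED FORM, PARAMETRICALLY IN THE FOUR LETTER FAMILIES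
# (leaf-12's (N1), leaf-01 g57's dressed envelope, d4-p3's I1, the translated tent bound) AT ONE COMMON RATE.

NOT IN PRINT; OUR BOOKKEEPING (G-an2-4 formalisation swarm, leaf prover `b2b-balaban-gan24-formalise-leaf-01`, gen 58; CT-3c under «MINE»; owner's GO
`CT3-MECHANISM-v1.2.md` §A∕§B (l.31770), choice (b) (l.31846 ∕ l.31868): the TIP-position dressed partners through leaf-03 g52's
`StaircasePairingReadings.abs_pairingTip_le_of_geometric`, the MIDPOINT one through the owner's `StaircasePairing.abs_pairing_le_sum`).  HONEST FRAMING (cell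
contract, verbatim): «discharging `BetaPertH` makes Bałaban's UV stability UNCONDITIONAL — a real constructive-QFT result; it is NOT the continuum limit and NOT the
Clay problem.»  HONEST DEPENDENCY (verbatim): «continuum YM on T⁴ ⇐ BetaPertH ∧ nine spine estimates (0/9 proved); BetaPertH ⇐ (D1) ∧ (D4) ∧ CAP+tail; G-an2-4
gates asym, D1 and NE2/3/4.»

WHAT (`d = 3`, in-block root `ρ = toSite rr`, `N = Lc^(k+1)`, `T = legChain (respStepBmSeq ρ Lc) 0 k`, `B = respStep (Lc^0) (Lc^(0+k+1))`, bond gauge functions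
`λ μ z = Psi ρ Lc 0 k (delta1 μ z) − bmGaugeAt ρ (B μ z) Lc`, tent forces `t_{μ,z} = 𝒬ᵀ_N φ_{μ,z}`, `φ_{μ,z} κ y = wΦ κ μ (y − z)`; letters: (N1) `C`, I1 `Φ₀` at the
common rate `κ₀`; derived `α = 8·Lc·C·(Lc^{5(k+1)})⁻¹`, `Eψ = 2α·Lc^k`, `C_B = C·(Lc^{5(k+1)})⁻¹`, `Φ₀′ = Φ₀·(Lc^{8(k+1)})⁻¹`, `τ = N·Φ₀′·e^{κ₀}`,
`ENV(p; q, r) = N^4·Zl 4 (κ₀∕16)·e^{−(κ₀∕12)(‖q−p‖∞+‖r−p‖∞)}`):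
* §1 = `ContactCellLetters` (the letters in the shapes the cells eat).
* §2 **`abs_cellL_bound`**: `|LEFT cell| ≤ ½·4·Eψe^{κ₀}·2C_Bτ·ENV(x′;u′,z′) + ½·4·P·ENV(z′;x′,u′) + ½·4·P·ENV(u′;x′,z′)`, `P = 8e^{5κ₀}α²Lc^k(2τ + Φ₀′Lc^k)`;
* §3 **`abs_cellR_bound`**: `|RIGHT cell| ≤ ½·4·Eψe^{κ₀}·2C_Bτ·ENV(z′;u′,x′) + ½·4·P·ENV(x′;z′,u′)`;
* §4 **`abs_cellW_bound`**: `|TABLE cell| ≤ ½·4·Eψe^{κ₀}·2C_Bτ·ENV(u′;x′,z′)` (leaf-02's `abs_cellIdx_le'` as it stands).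
[folklore] throughout: bookkeeping over leaf-02's cells, the owner's and leaf-03's staircase pairings, my `ContactCellReduction` ∕ `ContactGaugeStaircase` ∕
`ContactPartnerLetters` ∕ `ContactKernelCells` BY NAME; 0 `def`, 0 cited facts, 0 `def … : Prop`, 0 sorry.  NO new estimate; discharges NOTHING of (hS, hSall) on (E);
0 wall binders; NEVER «G-an2-4 closed»; NOT D1, NOT BetaPertH, NOT continuum, NOT Clay.
-/

noncomputable section

open Finset
open scoped BigOperators
open Literature.MathematicalPhysics.QuantumFieldTheory
open Literature.MathematicalPhysics.QuantumFieldTheory.LatticeForm (quo)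
open Literature.MathematicalPhysics.QuantumFieldTheory.Balaban1983to89
open Literature.MathematicalPhysics.QuantumFieldTheory.Balaban1983to89.Beta
open B4ContourShift (supNorm supNorm_nonneg)
open ExpKernelCalculus (Zl Zl_nonneg)
open AffineAveraging (Form0 Form1 Site box toSite curv curvAdj dz)
open AffineReproduction (contourSumAdj)
open AveragingContours (blk)
open KernelSpecInstance (wΦ)
open B6BondElimination (unitVec)
open KKTFluctuationKernel (delta1)
open BalabanCompositeJets (respStep)
open Summit.QuantumFields.BalabanUV.Beta.AxialProjectorBlockMean (bmGaugeAt)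
open Summit.QuantumFields.BalabanUV.Beta.GAN24.Push4Iter (LegFam legChain)
open Summit.QuantumFields.BalabanUV.Beta.GAN24.RespStepBmDecompLegs (legAct)
open Summit.QuantumFields.BalabanUV.Beta.GAN24.RespStepBmDecompExact (respStepBmSeq)
open Summit.QuantumFields.BalabanUV.Beta.GAN24.RespStepBmDecompPsi (Psi)
open Summit.QuantumFields.BalabanUV.Beta.GAN24.EnvelopeBlockSum (env_le_one summable_env)
open Summit.QuantumFields.BalabanUV.Beta.GAN24.ContactOneGaugeCellAlgebra (affine_unitVec_eq dz_apply')
open Summit.QuantumFields.BalabanUV.Beta.GAN24.ContactOneGaugeCellBound (tsum_env3_le abs_le_of_env summable_of_env)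
open Summit.QuantumFields.BalabanUV.Beta.GAN24.ContactOneGaugeCellTable (abs_cellIdx_le')
open Summit.QuantumFields.BalabanUV.Beta.GAN24.ContactCellReduction (abs_cellL_le_pieces abs_cellR_le_pieces abs_le_of_env₁ summable_of_env₁ env3_nonneg)
open Summit.QuantumFields.BalabanUV.Beta.GAN24.ContactKernelCells (legChain_respStepBmSeq_apply_eq_add_dz)
open Summit.QuantumFields.BalabanUV.Beta.GAN24.ContactPartnerLetters (curvAdj_curv_legChain_eq curvAdj_curv_respStep_one_eq_contourSumAdj respStep_pow_zero)
open Summit.QuantumFields.BalabanUV.Beta.GAN24.ContactGaugeStaircase (gauge_eq_staircase abs_gaugePiece_le)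
open Summit.QuantumFields.BalabanUV.Beta.GAN24.StaircasePairing (abs_pairing_le_sum sum_weights_le_of_geometric sum_pow_le)
open Summit.QuantumFields.BalabanUV.Beta.GAN24.StaircasePairingReadings (abs_pairingTip_le_of_geometric)
open Summit.QuantumFields.BalabanUV.Beta.GAN24.ContactCellLetters (abs_gauge_le legChain_apply_eq curvAdj_curv_respStep_zero_eq_contourSumAdj
  curvAdj_curv_legChain_zero_eq_contourSumAdj)

namespace Summit.QuantumFields.BalabanUV.Beta.GAN24.ContactCellBounds

variable {Lc : ℕ} [NeZero Lc]

/-! ## §2 The LEFT cell -/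

section Cells

variable {κ₀ C KE Φ₀ : ℝ} {rr : Fin (3 + 1) → ℕ}

/-- NOT IN PRINT; OUR BOOKKEEPING.  **THE LEFT CELL OF THE CONTACT TERM, BOUNDED** (`d = 3`, `2 ≤ Lc`, in-block root; parametric in the letters at one rate:
(N1) `C`, the dressed envelope `KE` (used only qualitatively: summability), I1 `Φ₀` and the translated tent bound): for every `k κ′ u′ x′ z′ α β`,
`|LEFT cell| ≤ ½·4·Eψe^{κ₀}·(C_Bτ + C_Bτ)·ENV(x′;u′,z′) + ½·4·P·ENV(z′;x′,u′) + ½·4·P·ENV(u′;x′,z′)`, `P = 8e^{5κ₀}α²Lc^k(2τ + Φ₀′Lc^k)` (notation of the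
module docstring). -/
theorem abs_cellL_bound (hLc : 2 ≤ Lc) (hrr : rr ∈ box (3 + 1) Lc) (hκ : 0 < κ₀) (hC : 0 ≤ C) (hΦ : 0 ≤ Φ₀)
    (hN1 : ∀ (m k : ℕ) (μ : Fin (3 + 1)) (z : Site (3 + 1)) (l'' : Fin (3 + 1)) (w' : Site (3 + 1)),
      |respStep (d := 3) (Lc ^ m) (Lc ^ (m + k + 1)) μ z l'' w'| ≤
        C * ((Lc : ℝ) ^ (5 * (k + 1)))⁻¹ * Real.exp (-(κ₀ * supNorm (quo (Lc ^ (k + 1)) w' - z))))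
    (hE : ∀ (k : ℕ) (μ : Fin (3 + 1)) (z : Site (3 + 1)) (κ : Fin (3 + 1)) (u : Site (3 + 1)),
      |legChain (respStepBmSeq (d := 3) (toSite rr) Lc) 0 k μ z κ u|
        ≤ KE * ((Lc : ℝ) ^ (4 * (k + 1)))⁻¹ * Real.exp (-(κ₀ * supNorm (quo (Lc ^ (k + 1)) u - z))))
    (hΦenv : ∀ (k : ℕ) (μ : Fin (3 + 1)) (z : Site (3 + 1)) (κ : Fin (3 + 1)) (y : Site (3 + 1)),
      |wΦ (N := Lc ^ (k + 1)) κ μ (y - z)| ≤ Φ₀ * ((Lc : ℝ) ^ (8 * (k + 1)))⁻¹ * Real.exp (-(κ₀ * supNorm (y - z))))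
    (ht : ∀ (k : ℕ) (μ : Fin (3 + 1)) (z : Site (3 + 1)) (κ : Fin (3 + 1)) (u : Site (3 + 1)),
      |contourSumAdj (Lc ^ (k + 1)) (fun κ y => wΦ (N := Lc ^ (k + 1)) κ μ (y - z)) κ u|
        ≤ (Lc ^ (k + 1) : ℕ) * (Φ₀ * ((Lc : ℝ) ^ (8 * (k + 1)))⁻¹) * Real.exp κ₀ * Real.exp (-(κ₀ * supNorm (quo (Lc ^ (k + 1)) u - z))))
    (k : ℕ) (κ' : Fin (3 + 1)) (u' x' z' : Site (3 + 1)) (α β : Fin (3 + 1)) :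
    |∑' z, ∑ b, legChain (respStepBmSeq (d := 3) (toSite rr) Lc) 0 k β z' b z *
        ∑' u, ∑ κ, legChain (respStepBmSeq (d := 3) (toSite rr) Lc) 0 k κ' u' κ u *
          ((1 / 2 : ℝ) *
            ((Psi (toSite rr) Lc 0 k (delta1 α x') - bmGaugeAt (toSite rr) (respStep (d := 3) (Lc ^ 0) (Lc ^ (0 + k + 1)) α x') Lc) (u + unitVec κ)
              - ((Psi (toSite rr) Lc 0 k (delta1 α x') - bmGaugeAt (toSite rr) (respStep (d := 3) (Lc ^ 0) (Lc ^ (0 + k + 1)) α x') Lc) z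
                + (Psi (toSite rr) Lc 0 k (delta1 α x') - bmGaugeAt (toSite rr) (respStep (d := 3) (Lc ^ 0) (Lc ^ (0 + k + 1)) α x') Lc)
                  (z + unitVec b)) / 2) * curvAdj (curv (delta1 κ u)) b z)|
      ≤ (1 / 2 : ℝ) * ((((3 : ℕ) : ℝ) + 1) * ((2 * (8 * (Lc : ℝ) * C * ((Lc : ℝ) ^ (5 * (k + 1)))⁻¹) * (Lc : ℝ) ^ k) * Real.exp κ₀) *
            ((C * ((Lc : ℝ) ^ (5 * (k + 1)))⁻¹) * ((Lc ^ (k + 1) : ℕ) * (Φ₀ * ((Lc : ℝ) ^ (8 * (k + 1)))⁻¹) * Real.exp κ₀)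
              + (C * ((Lc : ℝ) ^ (5 * (k + 1)))⁻¹) * ((Lc ^ (k + 1) : ℕ) * (Φ₀ * ((Lc : ℝ) ^ (8 * (k + 1)))⁻¹) * Real.exp κ₀))) *
          ((((Lc ^ (k + 1) : ℕ) : ℝ)) ^ (3 + 1) * Zl (3 + 1) (κ₀ / (4 * (((3 : ℕ) : ℝ) + 1))) *
            Real.exp (-(κ₀ / 12) * (supNorm (u' - x') + supNorm (z' - x'))))
        + (1 / 2 : ℝ) * ((((3 : ℕ) : ℝ) + 1) *
          ((8 * Real.exp (5 * κ₀) * (8 * (Lc : ℝ) * C * ((Lc : ℝ) ^ (5 * (k + 1)))⁻¹) * (8 * (Lc : ℝ) * C * ((Lc : ℝ) ^ (5 * (k + 1)))⁻¹) *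
              (Lc : ℝ) ^ k * (2 * ((Lc ^ (k + 1) : ℕ) * (Φ₀ * ((Lc : ℝ) ^ (8 * (k + 1)))⁻¹) * Real.exp κ₀)
                + (Φ₀ * ((Lc : ℝ) ^ (8 * (k + 1)))⁻¹) * (Lc : ℝ) ^ k)) *
            ((((Lc ^ (k + 1) : ℕ) : ℝ)) ^ (3 + 1) * Zl (3 + 1) (κ₀ / (4 * (((3 : ℕ) : ℝ) + 1))) *
              Real.exp (-(κ₀ / 12) * (supNorm (x' - z') + supNorm (u' - z'))))))
        + (1 / 2 : ℝ) * ((((3 : ℕ) : ℝ) + 1) *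
          ((8 * Real.exp (5 * κ₀) * (8 * (Lc : ℝ) * C * ((Lc : ℝ) ^ (5 * (k + 1)))⁻¹) * (8 * (Lc : ℝ) * C * ((Lc : ℝ) ^ (5 * (k + 1)))⁻¹) *
              (Lc : ℝ) ^ k * (2 * ((Lc ^ (k + 1) : ℕ) * (Φ₀ * ((Lc : ℝ) ^ (8 * (k + 1)))⁻¹) * Real.exp κ₀)
                + (Φ₀ * ((Lc : ℝ) ^ (8 * (k + 1)))⁻¹) * (Lc : ℝ) ^ k)) *
            ((((Lc ^ (k + 1) : ℕ) : ℝ)) ^ (3 + 1) * Zl (3 + 1) (κ₀ / (4 * (((3 : ℕ) : ℝ) + 1))) *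
              Real.exp (-(κ₀ / 12) * (supNorm (x' - u') + supNorm (z' - u')))))) := by
  haveI : NeZero (Lc ^ (k + 1)) := ⟨pow_ne_zero _ (NeZero.ne Lc)⟩
  have hL1 : 1 ≤ Lc := by omega
  have hN1' : 1 ≤ Lc ^ (k + 1) := Nat.one_le_pow _ _ (by omega)
  have hL0 : (0 : ℝ) ≤ (Lc : ℝ) := Nat.cast_nonneg _
  -- names
  set N : ℕ := Lc ^ (k + 1) with hNdef
  set T : LegFam 3 := legChain (respStepBmSeq (d := 3) (toSite rr) Lc) 0 k with hT
  set B : LegFam 3 := respStep (d := 3) (Lc ^ 0) (Lc ^ (0 + k + 1)) with hB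
  set lam : Fin (3 + 1) → Site (3 + 1) → Form0 (3 + 1) ℝ :=
    fun μ z => Psi (toSite rr) Lc 0 k (delta1 μ z) - bmGaugeAt (toSite rr) (B μ z) Lc with hlam
  set φ : Fin (3 + 1) → Site (3 + 1) → Form1 (3 + 1) ℝ := fun μ z κ y => wΦ (N := N) κ μ (y - z) with hφ
  set α0 : ℝ := 8 * (Lc : ℝ) * C * ((Lc : ℝ) ^ (5 * (k + 1)))⁻¹ with hα0
  set Eψ : ℝ := 2 * α0 * (Lc : ℝ) ^ k with hEψ
  set CB : ℝ := C * ((Lc : ℝ) ^ (5 * (k + 1)))⁻¹ with hCB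
  set Φ₀' : ℝ := Φ₀ * ((Lc : ℝ) ^ (8 * (k + 1)))⁻¹ with hΦ₀'
  set τ : ℝ := (N : ℕ) * Φ₀' * Real.exp κ₀ with hτ
  have hα00 : 0 ≤ α0 := by positivity
  have hEψ0 : 0 ≤ Eψ := by positivity
  have hCB0 : 0 ≤ CB := by positivity
  have hΦ₀'0 : 0 ≤ Φ₀' := by positivity
  have hτ0 : 0 ≤ τ := by positivity
  -- the letters of the three objects
  have hψenv : ∀ (μ : Fin (3 + 1)) (z : Site (3 + 1)) (u : Site (3 + 1)),
      |lam μ z u| ≤ Eψ * Real.exp (-(κ₀ * supNorm (quo N u - z))) := fun μ z u => abs_gauge_le hLc hC hN1 hrr k μ z u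
  have hTeq : ∀ (μ : Fin (3 + 1)) (z : Site (3 + 1)) (κ : Fin (3 + 1)) (u : Site (3 + 1)),
      T μ z κ u = B μ z κ u + (lam μ z (u + unitVec κ) - lam μ z u) := fun μ z κ u => legChain_apply_eq hrr k μ z κ u
  have hBenv : ∀ (μ : Fin (3 + 1)) (z : Site (3 + 1)) (κ : Fin (3 + 1)) (u : Site (3 + 1)),
      |B μ z κ u| ≤ CB * Real.exp (-(κ₀ * supNorm (quo N u - z))) := fun μ z κ u => hN1 0 k μ z κ u
  have hgb : ∀ (μ : Fin (3 + 1)) (z : Site (3 + 1)) (x : Site (3 + 1)), |lam μ z x| ≤ Eψ :=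
    fun μ z x => abs_le_of_env (L := N) hκ.le hEψ0 (hψenv μ z) x
  have hTs : ∀ (μ : Fin (3 + 1)) (z : Site (3 + 1)) (b : Fin (3 + 1)), Summable (T μ z b) :=
    fun μ z b => summable_of_env hN1' hκ (fun u => hE k μ z b u)
  have hM : ∀ (μ : Fin (3 + 1)) (z : Site (3 + 1)), curvAdj (curv (T μ z)) = contourSumAdj N (φ μ z) :=
    fun μ z => curvAdj_curv_legChain_zero_eq_contourSumAdj hrr k μ z
  have htenv : ∀ (μ : Fin (3 + 1)) (z : Site (3 + 1)) (κ : Fin (3 + 1)) (u : Site (3 + 1)),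
      |contourSumAdj N (φ μ z) κ u| ≤ τ * Real.exp (-(κ₀ * supNorm (quo N u - z))) := by
    intro μ z κ u; have h := ht k μ z κ u; rw [hτ]; exact h
  -- the reduction to pieces
  have hred := abs_cellL_le_pieces (N := N) (d := 3) hN1' hκ hEψ0 hCB0 hCB0 hτ0 hτ0 (ψ := lam α x') (c₀ := x')
    (T₁ := T κ' u') (T₃ := T β z') (B₁ := B κ' u') (B₃ := B β z') (lam₁ := lam κ' u') (lam₃ := lam β z') (c₁ := u') (c₃ := z')
    (φ₁ := φ κ' u') (φ₃ := φ β z') (hψenv α x') (hTeq κ' u') (hTeq β z') (hBenv κ' u') (hBenv β z') (hgb κ' u') (hgb β z') (hTs β z')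
    (hM κ' u') (hM β z') (htenv κ' u') (htenv β z')
  refine hred.trans ?_
  -- the staircase data of the two gauge functions and the tent data, for the pairing lemmas
  have hdvd : ∀ s, s ≤ k → Lc ^ s ∣ N := fun s hs => pow_dvd_pow Lc (by omega)
  have hφenv : ∀ (μ : Fin (3 + 1)) (z : Site (3 + 1)) (κ : Fin (3 + 1)) (y : Site (3 + 1)),
      |φ μ z κ y| ≤ Φ₀' * Real.exp (-(κ₀ * supNorm (y - z))) := fun μ z κ y => hΦenv k μ z κ y
  have hpiece := fun (μ : Fin (3 + 1)) (z : Site (3 + 1)) (s : ℕ) (hs : s ≤ k) (u : Site (3 + 1)) =>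
    abs_gaugePiece_le (Lc := Lc) hN1 hrr 0 k μ z hs u
  have hstair := fun (μ : Fin (3 + 1)) (z : Site (3 + 1)) (u : Site (3 + 1)) => gauge_eq_staircase (Lc := Lc) (toSite rr) 0 k μ z u
  have haL : ∀ s : ℕ, α0 * (Lc : ℝ) ^ s ≤ α0 * (Lc : ℝ) ^ s := fun s => le_rfl
  have ha0 : ∀ s : ℕ, 0 ≤ α0 * (Lc : ℝ) ^ s := fun s => by positivity
  -- tip pairing (partner 1 = table leg about u′) against the tent of partner 3 (about z′): per direction
  have htip : ∀ κ : Fin (3 + 1), |∑' u, contourSumAdj N (φ β z') κ u * lam α x' (u + AffineAveraging.unitVec κ) *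
      (lam κ' u' (u + AffineAveraging.unitVec κ) - lam κ' u' u)|
        ≤ (8 * Real.exp (5 * κ₀) * α0 * α0 * (Lc : ℝ) ^ k * (2 * τ + Φ₀' * (Lc : ℝ) ^ k)) *
          ∑' u : Site (3 + 1), Real.exp (-(κ₀ * supNorm (quo N u - z'))) * Real.exp (-(κ₀ * supNorm (quo N u - x'))) *
            Real.exp (-(κ₀ * supNorm (quo N u - u'))) := by
    intro κ
    exact abs_pairingTip_le_of_geometric (N := N) (Lc := Lc) (k := k) (y₀ := z') (c₁ := x') (c₂ := u') (φ := φ β z')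
      (G₁ := fun s y => if s = 0 then -bmGaugeAt (toSite rr) (respStep (d := 3) (Lc ^ 0) (Lc ^ (0 + k + 1)) α x') Lc y
        else -(((Lc : ℝ) ^ ((3 + 1) * s))⁻¹ * bmGaugeAt (toSite rr) (legAct (respStep (d := 3) (Lc ^ (0 + s)) (Lc ^ (0 + k + 1))) (delta1 α x')) Lc y))
      (G₂ := fun s y => if s = 0 then -bmGaugeAt (toSite rr) (respStep (d := 3) (Lc ^ 0) (Lc ^ (0 + k + 1)) κ' u') Lc y
        else -(((Lc : ℝ) ^ ((3 + 1) * s))⁻¹ * bmGaugeAt (toSite rr) (legAct (respStep (d := 3) (Lc ^ (0 + s)) (Lc ^ (0 + k + 1))) (delta1 κ' u')) Lc y))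
      (a := fun s => α0 * (Lc : ℝ) ^ s) (b := fun s => α0 * (Lc : ℝ) ^ s)
      hκ.le hτ0 hΦ₀'0 hLc hα00 hα00 ha0 ha0 haL haL hdvd (hφenv β z') (htenv β z')
      (fun s hs u => hpiece α x' s hs u) (fun s hs u => hpiece κ' u' s hs u) (tsum_env3_le hN1' hκ z' x' u').1
      (hstair α x') (hstair κ' u') κ
  -- midpoint pairing (partner 3 = right leg about z′) against the tent of partner 1 (about u′)
  have hmid : ∀ b : Fin (3 + 1), |∑' z, contourSumAdj N (φ κ' u') b z * ((lam α x' z + lam α x' (z + AffineAveraging.unitVec b)) / 2) *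
      (lam β z' (z + AffineAveraging.unitVec b) - lam β z' z)|
        ≤ (8 * Real.exp (5 * κ₀) * α0 * α0 * (Lc : ℝ) ^ k * (2 * τ + Φ₀' * (Lc : ℝ) ^ k)) *
          ∑' u : Site (3 + 1), Real.exp (-(κ₀ * supNorm (quo N u - u'))) * Real.exp (-(κ₀ * supNorm (quo N u - x'))) *
            Real.exp (-(κ₀ * supNorm (quo N u - z'))) := by
    intro b
    refine (abs_pairing_le_sum (N := N) (Lc := Lc) (k := k) (y₀ := u') (c₁ := x') (c₂ := z') (φ := φ κ' u')
      (G₁ := fun s y => if s = 0 then -bmGaugeAt (toSite rr) (respStep (d := 3) (Lc ^ 0) (Lc ^ (0 + k + 1)) α x') Lc y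
        else -(((Lc : ℝ) ^ ((3 + 1) * s))⁻¹ * bmGaugeAt (toSite rr) (legAct (respStep (d := 3) (Lc ^ (0 + s)) (Lc ^ (0 + k + 1))) (delta1 α x')) Lc y))
      (G₂ := fun s y => if s = 0 then -bmGaugeAt (toSite rr) (respStep (d := 3) (Lc ^ 0) (Lc ^ (0 + k + 1)) β z') Lc y
        else -(((Lc : ℝ) ^ ((3 + 1) * s))⁻¹ * bmGaugeAt (toSite rr) (legAct (respStep (d := 3) (Lc ^ (0 + s)) (Lc ^ (0 + k + 1))) (delta1 β z')) Lc y))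
      (a := fun s => α0 * (Lc : ℝ) ^ s) (b := fun s => α0 * (Lc : ℝ) ^ s)
      hκ.le hτ0 hΦ₀'0 hL1 ha0 ha0 hdvd (hφenv κ' u') (htenv κ' u')
      (fun s hs u => hpiece α x' s hs u) (fun s hs u => hpiece β z' s hs u) (tsum_env3_le hN1' hκ u' x' z').1
      (hstair α x') (hstair β z') b).trans ?_
    exact mul_le_mul_of_nonneg_right (sum_weights_le_of_geometric hLc hκ.le hτ0 hΦ₀'0 hα00 hα00 ha0 ha0 haL haL)
      (tsum_nonneg fun u => by positivity)
  -- the two envelope sums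
  have hS3 := (tsum_env3_le (d := 3) hN1' hκ z' x' u').2
  have hS1 := (tsum_env3_le (d := 3) hN1' hκ u' x' z').2
  have hP0 : 0 ≤ 8 * Real.exp (5 * κ₀) * α0 * α0 * (Lc : ℝ) ^ k * (2 * τ + Φ₀' * (Lc : ℝ) ^ k) := by positivity
  have htipS : ∑ κ : Fin (3 + 1), |∑' u, contourSumAdj N (φ β z') κ u * lam α x' (u + AffineAveraging.unitVec κ) *
      (lam κ' u' (u + AffineAveraging.unitVec κ) - lam κ' u' u)|
        ≤ (((3 : ℕ) : ℝ) + 1) * ((8 * Real.exp (5 * κ₀) * α0 * α0 * (Lc : ℝ) ^ k * (2 * τ + Φ₀' * (Lc : ℝ) ^ k)) *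
          ((((N : ℕ) : ℝ)) ^ (3 + 1) * Zl (3 + 1) (κ₀ / (4 * (((3 : ℕ) : ℝ) + 1))) *
            Real.exp (-(κ₀ / 12) * (supNorm (x' - z') + supNorm (u' - z'))))) := by
    calc ∑ κ : Fin (3 + 1), |∑' u, contourSumAdj N (φ β z') κ u * lam α x' (u + AffineAveraging.unitVec κ) *
          (lam κ' u' (u + AffineAveraging.unitVec κ) - lam κ' u' u)|
        ≤ ∑ _κ : Fin (3 + 1), (8 * Real.exp (5 * κ₀) * α0 * α0 * (Lc : ℝ) ^ k * (2 * τ + Φ₀' * (Lc : ℝ) ^ k)) *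
          ((((N : ℕ) : ℝ)) ^ (3 + 1) * Zl (3 + 1) (κ₀ / (4 * (((3 : ℕ) : ℝ) + 1))) *
            Real.exp (-(κ₀ / 12) * (supNorm (x' - z') + supNorm (u' - z')))) :=
          Finset.sum_le_sum fun κ _ => (htip κ).trans (mul_le_mul_of_nonneg_left hS3 hP0)
      _ = _ := by rw [Finset.sum_const, Finset.card_univ, Fintype.card_fin, nsmul_eq_mul]; push_cast; ring
  have hmidS : ∑ b : Fin (3 + 1), |∑' z, contourSumAdj N (φ κ' u') b z * ((lam α x' z + lam α x' (z + AffineAveraging.unitVec b)) / 2) *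
      (lam β z' (z + AffineAveraging.unitVec b) - lam β z' z)|
        ≤ (((3 : ℕ) : ℝ) + 1) * ((8 * Real.exp (5 * κ₀) * α0 * α0 * (Lc : ℝ) ^ k * (2 * τ + Φ₀' * (Lc : ℝ) ^ k)) *
          ((((N : ℕ) : ℝ)) ^ (3 + 1) * Zl (3 + 1) (κ₀ / (4 * (((3 : ℕ) : ℝ) + 1))) *
            Real.exp (-(κ₀ / 12) * (supNorm (x' - u') + supNorm (z' - u'))))) := by
    calc ∑ b : Fin (3 + 1), |∑' z, contourSumAdj N (φ κ' u') b z * ((lam α x' z + lam α x' (z + AffineAveraging.unitVec b)) / 2) *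
          (lam β z' (z + AffineAveraging.unitVec b) - lam β z' z)|
        ≤ ∑ _b : Fin (3 + 1), (8 * Real.exp (5 * κ₀) * α0 * α0 * (Lc : ℝ) ^ k * (2 * τ + Φ₀' * (Lc : ℝ) ^ k)) *
          ((((N : ℕ) : ℝ)) ^ (3 + 1) * Zl (3 + 1) (κ₀ / (4 * (((3 : ℕ) : ℝ) + 1))) *
            Real.exp (-(κ₀ / 12) * (supNorm (x' - u') + supNorm (z' - u')))) :=
          Finset.sum_le_sum fun b _ => (hmid b).trans (mul_le_mul_of_nonneg_left hS1 hP0)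
      _ = _ := by rw [Finset.sum_const, Finset.card_univ, Fintype.card_fin, nsmul_eq_mul]; push_cast; ring
  have h12 : (0 : ℝ) ≤ 1 / 2 := by norm_num
  have := add_le_add (add_le_add (le_refl ((1 / 2 : ℝ) * ((((3 : ℕ) : ℝ) + 1) * (Eψ * Real.exp κ₀) * (CB * τ + CB * τ)) *
          ((((N : ℕ) : ℝ)) ^ (3 + 1) * Zl (3 + 1) (κ₀ / (4 * (((3 : ℕ) : ℝ) + 1))) *
            Real.exp (-(κ₀ / 12) * (supNorm (u' - x') + supNorm (z' - x'))))))
    (mul_le_mul_of_nonneg_left htipS h12)) (mul_le_mul_of_nonneg_left hmidS h12)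
  exact this

/-! ## §3 The RIGHT cell -/

/-- NOT IN PRINT; OUR BOOKKEEPING.  **THE RIGHT CELL OF THE CONTACT TERM, BOUNDED** (the outer partner `B α x′` UNDRESSED; the inner partner `T κ′ u′` dressed in
the tip position; gauge weight `λ β z′`): `|RIGHT cell| ≤ ½·4·Eψe^{κ₀}(C_Bτ + C_Bτ)·ENV(z′;u′,x′) + ½·4·P·ENV(x′;z′,u′)`. -/
theorem abs_cellR_bound (hLc : 2 ≤ Lc) (hrr : rr ∈ box (3 + 1) Lc) (hκ : 0 < κ₀) (hC : 0 ≤ C) (hΦ : 0 ≤ Φ₀)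
    (hN1 : ∀ (m k : ℕ) (μ : Fin (3 + 1)) (z : Site (3 + 1)) (l'' : Fin (3 + 1)) (w' : Site (3 + 1)),
      |respStep (d := 3) (Lc ^ m) (Lc ^ (m + k + 1)) μ z l'' w'| ≤
        C * ((Lc : ℝ) ^ (5 * (k + 1)))⁻¹ * Real.exp (-(κ₀ * supNorm (quo (Lc ^ (k + 1)) w' - z))))
    (hΦenv : ∀ (k : ℕ) (μ : Fin (3 + 1)) (z : Site (3 + 1)) (κ : Fin (3 + 1)) (y : Site (3 + 1)),
      |wΦ (N := Lc ^ (k + 1)) κ μ (y - z)| ≤ Φ₀ * ((Lc : ℝ) ^ (8 * (k + 1)))⁻¹ * Real.exp (-(κ₀ * supNorm (y - z))))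
    (ht : ∀ (k : ℕ) (μ : Fin (3 + 1)) (z : Site (3 + 1)) (κ : Fin (3 + 1)) (u : Site (3 + 1)),
      |contourSumAdj (Lc ^ (k + 1)) (fun κ y => wΦ (N := Lc ^ (k + 1)) κ μ (y - z)) κ u|
        ≤ (Lc ^ (k + 1) : ℕ) * (Φ₀ * ((Lc : ℝ) ^ (8 * (k + 1)))⁻¹) * Real.exp κ₀ * Real.exp (-(κ₀ * supNorm (quo (Lc ^ (k + 1)) u - z))))
    (k : ℕ) (κ' : Fin (3 + 1)) (u' x' z' : Site (3 + 1)) (α β : Fin (3 + 1)) :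
    |∑' x, ∑ a, respStep (d := 3) (Lc ^ 0) (Lc ^ (0 + k + 1)) α x' a x *
        ∑' u, ∑ κ, legChain (respStepBmSeq (d := 3) (toSite rr) Lc) 0 k κ' u' κ u *
          ((1 / 2 : ℝ) *
            ((Psi (toSite rr) Lc 0 k (delta1 β z') - bmGaugeAt (toSite rr) (respStep (d := 3) (Lc ^ 0) (Lc ^ (0 + k + 1)) β z') Lc) (u + unitVec κ)
              - ((Psi (toSite rr) Lc 0 k (delta1 β z') - bmGaugeAt (toSite rr) (respStep (d := 3) (Lc ^ 0) (Lc ^ (0 + k + 1)) β z') Lc) x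
                + (Psi (toSite rr) Lc 0 k (delta1 β z') - bmGaugeAt (toSite rr) (respStep (d := 3) (Lc ^ 0) (Lc ^ (0 + k + 1)) β z') Lc)
                  (x + unitVec a)) / 2) * curvAdj (curv (delta1 κ u)) a x)|
      ≤ (1 / 2 : ℝ) * ((((3 : ℕ) : ℝ) + 1) * ((2 * (8 * (Lc : ℝ) * C * ((Lc : ℝ) ^ (5 * (k + 1)))⁻¹) * (Lc : ℝ) ^ k) * Real.exp κ₀) *
            ((C * ((Lc : ℝ) ^ (5 * (k + 1)))⁻¹) * ((Lc ^ (k + 1) : ℕ) * (Φ₀ * ((Lc : ℝ) ^ (8 * (k + 1)))⁻¹) * Real.exp κ₀)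
              + (C * ((Lc : ℝ) ^ (5 * (k + 1)))⁻¹) * ((Lc ^ (k + 1) : ℕ) * (Φ₀ * ((Lc : ℝ) ^ (8 * (k + 1)))⁻¹) * Real.exp κ₀))) *
          ((((Lc ^ (k + 1) : ℕ) : ℝ)) ^ (3 + 1) * Zl (3 + 1) (κ₀ / (4 * (((3 : ℕ) : ℝ) + 1))) *
            Real.exp (-(κ₀ / 12) * (supNorm (u' - z') + supNorm (x' - z'))))
        + (1 / 2 : ℝ) * ((((3 : ℕ) : ℝ) + 1) *
          ((8 * Real.exp (5 * κ₀) * (8 * (Lc : ℝ) * C * ((Lc : ℝ) ^ (5 * (k + 1)))⁻¹) * (8 * (Lc : ℝ) * C * ((Lc : ℝ) ^ (5 * (k + 1)))⁻¹) *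
              (Lc : ℝ) ^ k * (2 * ((Lc ^ (k + 1) : ℕ) * (Φ₀ * ((Lc : ℝ) ^ (8 * (k + 1)))⁻¹) * Real.exp κ₀)
                + (Φ₀ * ((Lc : ℝ) ^ (8 * (k + 1)))⁻¹) * (Lc : ℝ) ^ k)) *
            ((((Lc ^ (k + 1) : ℕ) : ℝ)) ^ (3 + 1) * Zl (3 + 1) (κ₀ / (4 * (((3 : ℕ) : ℝ) + 1))) *
              Real.exp (-(κ₀ / 12) * (supNorm (z' - x') + supNorm (u' - x')))))) := by
  haveI : NeZero (Lc ^ (k + 1)) := ⟨pow_ne_zero _ (NeZero.ne Lc)⟩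
  have hL1 : 1 ≤ Lc := by omega
  have hN1' : 1 ≤ Lc ^ (k + 1) := Nat.one_le_pow _ _ (by omega)
  set N : ℕ := Lc ^ (k + 1) with hNdef
  set T : LegFam 3 := legChain (respStepBmSeq (d := 3) (toSite rr) Lc) 0 k with hT
  set B : LegFam 3 := respStep (d := 3) (Lc ^ 0) (Lc ^ (0 + k + 1)) with hB
  set lam : Fin (3 + 1) → Site (3 + 1) → Form0 (3 + 1) ℝ :=
    fun μ z => Psi (toSite rr) Lc 0 k (delta1 μ z) - bmGaugeAt (toSite rr) (B μ z) Lc with hlam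
  set φ : Fin (3 + 1) → Site (3 + 1) → Form1 (3 + 1) ℝ := fun μ z κ y => wΦ (N := N) κ μ (y - z) with hφ
  set α0 : ℝ := 8 * (Lc : ℝ) * C * ((Lc : ℝ) ^ (5 * (k + 1)))⁻¹ with hα0
  set Eψ : ℝ := 2 * α0 * (Lc : ℝ) ^ k with hEψ
  set CB : ℝ := C * ((Lc : ℝ) ^ (5 * (k + 1)))⁻¹ with hCB
  set Φ₀' : ℝ := Φ₀ * ((Lc : ℝ) ^ (8 * (k + 1)))⁻¹ with hΦ₀'
  set τ : ℝ := (N : ℕ) * Φ₀' * Real.exp κ₀ with hτ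
  have hα00 : 0 ≤ α0 := by positivity
  have hEψ0 : 0 ≤ Eψ := by positivity
  have hCB0 : 0 ≤ CB := by positivity
  have hΦ₀'0 : 0 ≤ Φ₀' := by positivity
  have hτ0 : 0 ≤ τ := by positivity
  have hψenv : ∀ (μ : Fin (3 + 1)) (z : Site (3 + 1)) (u : Site (3 + 1)),
      |lam μ z u| ≤ Eψ * Real.exp (-(κ₀ * supNorm (quo N u - z))) := fun μ z u => abs_gauge_le hLc hC hN1 hrr k μ z u
  have hTeq : ∀ (μ : Fin (3 + 1)) (z : Site (3 + 1)) (κ : Fin (3 + 1)) (u : Site (3 + 1)),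
      T μ z κ u = B μ z κ u + (lam μ z (u + unitVec κ) - lam μ z u) := fun μ z κ u => legChain_apply_eq hrr k μ z κ u
  have hBenv : ∀ (μ : Fin (3 + 1)) (z : Site (3 + 1)) (κ : Fin (3 + 1)) (u : Site (3 + 1)),
      |B μ z κ u| ≤ CB * Real.exp (-(κ₀ * supNorm (quo N u - z))) := fun μ z κ u => hN1 0 k μ z κ u
  have hgb : ∀ (μ : Fin (3 + 1)) (z : Site (3 + 1)) (x : Site (3 + 1)), |lam μ z x| ≤ Eψ :=
    fun μ z x => abs_le_of_env (L := N) hκ.le hEψ0 (hψenv μ z) x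
  have hM : ∀ (μ : Fin (3 + 1)) (z : Site (3 + 1)), curvAdj (curv (T μ z)) = contourSumAdj N (φ μ z) :=
    fun μ z => curvAdj_curv_legChain_zero_eq_contourSumAdj hrr k μ z
  have hMB : ∀ (μ : Fin (3 + 1)) (z : Site (3 + 1)), curvAdj (curv (B μ z)) = contourSumAdj N (φ μ z) :=
    fun μ z => curvAdj_curv_respStep_zero_eq_contourSumAdj (Lc := Lc) k μ z
  have htenv : ∀ (μ : Fin (3 + 1)) (z : Site (3 + 1)) (κ : Fin (3 + 1)) (u : Site (3 + 1)),
      |contourSumAdj N (φ μ z) κ u| ≤ τ * Real.exp (-(κ₀ * supNorm (quo N u - z))) := by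
    intro μ z κ u; have h := ht k μ z κ u; rw [hτ]; exact h
  have hred := abs_cellR_le_pieces (N := N) (d := 3) hN1' hκ hEψ0 hCB0 hCB0 hτ0 hτ0 (ψ := lam β z') (c₀ := z')
    (T₁ := T κ' u') (B₁ := B κ' u') (B₃ := B α x') (lam₁ := lam κ' u') (c₁ := u') (c₃ := x') (φ₁ := φ κ' u') (φ₃ := φ α x')
    (hψenv β z') (hTeq κ' u') (hBenv κ' u') (hBenv α x') (hgb κ' u') (hM κ' u') (hMB α x') (htenv κ' u') (htenv α x')
  refine hred.trans ?_
  have hdvd : ∀ s, s ≤ k → Lc ^ s ∣ N := fun s hs => pow_dvd_pow Lc (by omega)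
  have hφenv : ∀ (μ : Fin (3 + 1)) (z : Site (3 + 1)) (κ : Fin (3 + 1)) (y : Site (3 + 1)),
      |φ μ z κ y| ≤ Φ₀' * Real.exp (-(κ₀ * supNorm (y - z))) := fun μ z κ y => hΦenv k μ z κ y
  have hpiece := fun (μ : Fin (3 + 1)) (z : Site (3 + 1)) (s : ℕ) (hs : s ≤ k) (u : Site (3 + 1)) =>
    abs_gaugePiece_le (Lc := Lc) hN1 hrr 0 k μ z hs u
  have hstair := fun (μ : Fin (3 + 1)) (z : Site (3 + 1)) (u : Site (3 + 1)) => gauge_eq_staircase (Lc := Lc) (toSite rr) 0 k μ z u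
  have haL : ∀ s : ℕ, α0 * (Lc : ℝ) ^ s ≤ α0 * (Lc : ℝ) ^ s := fun s => le_rfl
  have ha0 : ∀ s : ℕ, 0 ≤ α0 * (Lc : ℝ) ^ s := fun s => by positivity
  have htip : ∀ κ : Fin (3 + 1), |∑' u, contourSumAdj N (φ α x') κ u * lam β z' (u + AffineAveraging.unitVec κ) *
      (lam κ' u' (u + AffineAveraging.unitVec κ) - lam κ' u' u)|
        ≤ (8 * Real.exp (5 * κ₀) * α0 * α0 * (Lc : ℝ) ^ k * (2 * τ + Φ₀' * (Lc : ℝ) ^ k)) *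
          ∑' u : Site (3 + 1), Real.exp (-(κ₀ * supNorm (quo N u - x'))) * Real.exp (-(κ₀ * supNorm (quo N u - z'))) *
            Real.exp (-(κ₀ * supNorm (quo N u - u'))) := by
    intro κ
    exact abs_pairingTip_le_of_geometric (N := N) (Lc := Lc) (k := k) (y₀ := x') (c₁ := z') (c₂ := u') (φ := φ α x')
      (G₁ := fun s y => if s = 0 then -bmGaugeAt (toSite rr) (respStep (d := 3) (Lc ^ 0) (Lc ^ (0 + k + 1)) β z') Lc y
        else -(((Lc : ℝ) ^ ((3 + 1) * s))⁻¹ * bmGaugeAt (toSite rr) (legAct (respStep (d := 3) (Lc ^ (0 + s)) (Lc ^ (0 + k + 1))) (delta1 β z')) Lc y))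
      (G₂ := fun s y => if s = 0 then -bmGaugeAt (toSite rr) (respStep (d := 3) (Lc ^ 0) (Lc ^ (0 + k + 1)) κ' u') Lc y
        else -(((Lc : ℝ) ^ ((3 + 1) * s))⁻¹ * bmGaugeAt (toSite rr) (legAct (respStep (d := 3) (Lc ^ (0 + s)) (Lc ^ (0 + k + 1))) (delta1 κ' u')) Lc y))
      (a := fun s => α0 * (Lc : ℝ) ^ s) (b := fun s => α0 * (Lc : ℝ) ^ s)
      hκ.le hτ0 hΦ₀'0 hLc hα00 hα00 ha0 ha0 haL haL hdvd (hφenv α x') (htenv α x')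
      (fun s hs u => hpiece β z' s hs u) (fun s hs u => hpiece κ' u' s hs u) (tsum_env3_le hN1' hκ x' z' u').1
      (hstair β z') (hstair κ' u') κ
  have hS3 := (tsum_env3_le (d := 3) hN1' hκ x' z' u').2
  have hP0 : 0 ≤ 8 * Real.exp (5 * κ₀) * α0 * α0 * (Lc : ℝ) ^ k * (2 * τ + Φ₀' * (Lc : ℝ) ^ k) := by positivity
  have htipS : ∑ κ : Fin (3 + 1), |∑' u, contourSumAdj N (φ α x') κ u * lam β z' (u + AffineAveraging.unitVec κ) *
      (lam κ' u' (u + AffineAveraging.unitVec κ) - lam κ' u' u)|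
        ≤ (((3 : ℕ) : ℝ) + 1) * ((8 * Real.exp (5 * κ₀) * α0 * α0 * (Lc : ℝ) ^ k * (2 * τ + Φ₀' * (Lc : ℝ) ^ k)) *
          ((((N : ℕ) : ℝ)) ^ (3 + 1) * Zl (3 + 1) (κ₀ / (4 * (((3 : ℕ) : ℝ) + 1))) *
            Real.exp (-(κ₀ / 12) * (supNorm (z' - x') + supNorm (u' - x'))))) := by
    calc ∑ κ : Fin (3 + 1), |∑' u, contourSumAdj N (φ α x') κ u * lam β z' (u + AffineAveraging.unitVec κ) *
          (lam κ' u' (u + AffineAveraging.unitVec κ) - lam κ' u' u)|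
        ≤ ∑ _κ : Fin (3 + 1), (8 * Real.exp (5 * κ₀) * α0 * α0 * (Lc : ℝ) ^ k * (2 * τ + Φ₀' * (Lc : ℝ) ^ k)) *
          ((((N : ℕ) : ℝ)) ^ (3 + 1) * Zl (3 + 1) (κ₀ / (4 * (((3 : ℕ) : ℝ) + 1))) *
            Real.exp (-(κ₀ / 12) * (supNorm (z' - x') + supNorm (u' - x')))) :=
          Finset.sum_le_sum fun κ _ => (htip κ).trans (mul_le_mul_of_nonneg_left hS3 hP0)
      _ = _ := by rw [Finset.sum_const, Finset.card_univ, Fintype.card_fin, nsmul_eq_mul]; push_cast; ring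
  have h12 : (0 : ℝ) ≤ 1 / 2 := by norm_num
  exact add_le_add (le_refl _) (mul_le_mul_of_nonneg_left htipS h12)

/-! ## §4 The TABLE cell -/

/-- NOT IN PRINT; OUR BOOKKEEPING.  **THE TABLE CELL OF THE CONTACT TERM, BOUNDED** (both partners undressed; site weights; leaf-02's `abs_cellIdx_le'` as it
stands): `|TABLE cell| ≤ ½·4·Eψe^{κ₀}(C_Bτ + C_Bτ)·ENV(u′;x′,z′)`. -/
theorem abs_cellW_bound (hLc : 2 ≤ Lc) (hrr : rr ∈ box (3 + 1) Lc) (hκ : 0 < κ₀) (hC : 0 ≤ C) (hΦ : 0 ≤ Φ₀)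
    (hN1 : ∀ (m k : ℕ) (μ : Fin (3 + 1)) (z : Site (3 + 1)) (l'' : Fin (3 + 1)) (w' : Site (3 + 1)),
      |respStep (d := 3) (Lc ^ m) (Lc ^ (m + k + 1)) μ z l'' w'| ≤
        C * ((Lc : ℝ) ^ (5 * (k + 1)))⁻¹ * Real.exp (-(κ₀ * supNorm (quo (Lc ^ (k + 1)) w' - z))))
    (ht : ∀ (k : ℕ) (μ : Fin (3 + 1)) (z : Site (3 + 1)) (κ : Fin (3 + 1)) (u : Site (3 + 1)),
      |contourSumAdj (Lc ^ (k + 1)) (fun κ y => wΦ (N := Lc ^ (k + 1)) κ μ (y - z)) κ u|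
        ≤ (Lc ^ (k + 1) : ℕ) * (Φ₀ * ((Lc : ℝ) ^ (8 * (k + 1)))⁻¹) * Real.exp κ₀ * Real.exp (-(κ₀ * supNorm (quo (Lc ^ (k + 1)) u - z))))
    (k : ℕ) (κ' : Fin (3 + 1)) (u' x' z' : Site (3 + 1)) (α β : Fin (3 + 1)) :
    |∑' z, ∑ b, respStep (d := 3) (Lc ^ 0) (Lc ^ (0 + k + 1)) β z' b z *
        ∑' x, ∑ a, respStep (d := 3) (Lc ^ 0) (Lc ^ (0 + k + 1)) α x' a x *
          ((1 / 2 : ℝ) *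
            ((Psi (toSite rr) Lc 0 k (delta1 κ' u') - bmGaugeAt (toSite rr) (respStep (d := 3) (Lc ^ 0) (Lc ^ (0 + k + 1)) κ' u') Lc) z
              - (Psi (toSite rr) Lc 0 k (delta1 κ' u') - bmGaugeAt (toSite rr) (respStep (d := 3) (Lc ^ 0) (Lc ^ (0 + k + 1)) κ' u') Lc) x) *
            curvAdj (curv (delta1 b z)) a x)|
      ≤ (1 / 2 : ℝ) * ((((3 : ℕ) : ℝ) + 1) * ((2 * (8 * (Lc : ℝ) * C * ((Lc : ℝ) ^ (5 * (k + 1)))⁻¹) * (Lc : ℝ) ^ k) * Real.exp κ₀) *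
            ((C * ((Lc : ℝ) ^ (5 * (k + 1)))⁻¹) * ((Lc ^ (k + 1) : ℕ) * (Φ₀ * ((Lc : ℝ) ^ (8 * (k + 1)))⁻¹) * Real.exp κ₀)
              + (C * ((Lc : ℝ) ^ (5 * (k + 1)))⁻¹) * ((Lc ^ (k + 1) : ℕ) * (Φ₀ * ((Lc : ℝ) ^ (8 * (k + 1)))⁻¹) * Real.exp κ₀))) *
          ((((Lc ^ (k + 1) : ℕ) : ℝ)) ^ (3 + 1) * Zl (3 + 1) (κ₀ / (4 * (((3 : ℕ) : ℝ) + 1))) *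
            Real.exp (-(κ₀ / 12) * (supNorm (x' - u') + supNorm (z' - u')))) := by
  haveI : NeZero (Lc ^ (k + 1)) := ⟨pow_ne_zero _ (NeZero.ne Lc)⟩
  have hN1' : 1 ≤ Lc ^ (k + 1) := Nat.one_le_pow _ _ (by omega)
  set N : ℕ := Lc ^ (k + 1) with hNdef
  have hCB0 : 0 ≤ C * ((Lc : ℝ) ^ (5 * (k + 1)))⁻¹ := by positivity
  have hτ0 : 0 ≤ (N : ℕ) * (Φ₀ * ((Lc : ℝ) ^ (8 * (k + 1)))⁻¹) * Real.exp κ₀ := by positivity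
  have hEψ0 : 0 ≤ 2 * (8 * (Lc : ℝ) * C * ((Lc : ℝ) ^ (5 * (k + 1)))⁻¹) * (Lc : ℝ) ^ k := by positivity
  have hMB : ∀ (μ : Fin (3 + 1)) (z : Site (3 + 1)) (a : Fin (3 + 1)) (x : Site (3 + 1)),
      |curvAdj (curv (respStep (d := 3) (Lc ^ 0) (Lc ^ (0 + k + 1)) μ z)) a x|
        ≤ (N : ℕ) * (Φ₀ * ((Lc : ℝ) ^ (8 * (k + 1)))⁻¹) * Real.exp κ₀ * Real.exp (-(κ₀ * supNorm (quo N x - z))) := by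
    intro μ z a x
    rw [curvAdj_curv_respStep_zero_eq_contourSumAdj]
    exact ht k μ z a x
  exact abs_cellIdx_le' (d := 3) (L := N) hN1' hκ (z₀ := u') (zL := x') (zR := z') hEψ0 hCB0 hCB0 hτ0 hτ0
    (abs_gauge_le hLc hC hN1 hrr k κ' u') (fun a x => hN1 0 k α x' a x) (hMB α x') (fun b z => hN1 0 k β z' b z) (hMB β z')

end Cells

end Summit.QuantumFields.BalabanUV.Beta.GAN24.ContactCellBounds

end
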